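import Mathlib

/-!
# Ventures/CertifiedManyBodySolver — Conjectures/RobinNodeLattice.lean: the node-lattice identities of **T-M1D.49 Lemma 1**, TYPED AND PROVED

HONEST FRAMING: first certified bounds; not a superconductivity verdict; every number certified or labelled float.

Source: `HOME/sr-mbsolver-m1-4/structure/design/BLINDNESS-ASYMPTOTICS.md` (T-M1D.49; sr-mbsolver-m1-4 gen 18, 2026-08-25), §1 (I0)–(I2) and
§2 Lemma 1; `structure/shells/SHELL-LAW.md` §20.

THE STATEMENT IN WORDS (paper-level). In the Robin (rank-one corner) designs of the certified `n`-site one-body window, both shell parities are ONE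
node lattice `Ψ(k) = (n k/2 - θ(k))/π ∈ ℤ + s` with the Robin phase `θ(k) = arctan(λ′ cot(k/2))`, and every node carries the Christoffel-type weight
`1/(n + G(k))` with `G = λ′/(sin²(k/2) + λ′² cos²(k/2)) = -2 θ′ = sin 2θ / sin k`.  The cap sums of Lemma 1 are then composite-midpoint sums in the
variable `x = Ψ(k)`, `dx/dk = (n + G)/(2π)`, which is what makes the Euler–Maclaurin expansion of T-M1D.49 Theorem 1 run.

WHAT IS TYPED AND PROVED HERE (exactly these real-variable statements about `θ(k) = arctan (l·cos(k/2)/sin(k/2))` for `sin(k/2) ≠ 0`; nothing about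
the Hubbard chain is asserted):
* `sin_two_mul_arctan_mul`, `cos_two_mul_arctan_mul` — `sin(2 arctan t)(1+t²) = 2t`, `cos(2 arctan t)(1+t²) = 1 - t²` (public; the tree has them only
  as private lemmas elsewhere);
* `weight_identity` (I1) — `sin(2θ(k)) · D = l · sin k`, `D := sin²(k/2) + l² cos²(k/2)`, i.e. `G sin k = sin 2θ`;
* `cos_two_theta_identity` (I2, algebraic part) — `cos(2θ(k)) · D = sin²(k/2) - l² cos²(k/2)`;
* `hasDerivAt_theta` (I0, local form) — `θ′(k) = -G(k)/2`;  `hasDerivAt_theta_param` — `∂θ/∂l = sin(k/2)cos(k/2)/D`;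
* `hasDerivAt_nodePhase` — `Ψ′(k) = (n + G(k))/(2π)` for `Ψ(k) = (n k/2 - θ(k))/π`.
-/

namespace Summit.Ventures.CertifiedManyBodySolver.Conjectures.RobinNodeLattice

open Real

/-- `sin (2 arctan t) · (1 + t²) = 2 t`. -/
theorem sin_two_mul_arctan_mul (t : ℝ) : sin (2 * arctan t) * (1 + t ^ 2) = 2 * t := by
  have h : 0 < 1 + t ^ 2 := by positivity
  have hs2 : sqrt (1 + t ^ 2) * sqrt (1 + t ^ 2) = 1 + t ^ 2 := mul_self_sqrt h.le
  rw [sin_two_mul, sin_arctan, cos_arctan]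
  calc 2 * (t / sqrt (1 + t ^ 2)) * (1 / sqrt (1 + t ^ 2)) * (1 + t ^ 2)
      = 2 * t * ((1 + t ^ 2) / (sqrt (1 + t ^ 2) * sqrt (1 + t ^ 2))) := by ring
    _ = 2 * t := by rw [hs2, div_self h.ne', mul_one]

/-- `cos (2 arctan t) · (1 + t²) = 1 - t²`. -/
theorem cos_two_mul_arctan_mul (t : ℝ) : cos (2 * arctan t) * (1 + t ^ 2) = 1 - t ^ 2 := by
  have h : (1 : ℝ) + t ^ 2 ≠ 0 := by positivity
  rw [cos_two_mul, cos_sq_arctan]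
  field_simp
  ring

/-- The Robin denominator `D = sin²(k/2) + l² cos²(k/2)` is positive off the lattice of zeros of `sin(k/2)`. -/
theorem denom_pos (l : ℝ) {k : ℝ} (hk : sin (k / 2) ≠ 0) : 0 < sin (k / 2) ^ 2 + l ^ 2 * cos (k / 2) ^ 2 := by
  positivity

/-- (I1) WEIGHT IDENTITY `G · sin k = sin 2θ`, division-free: `sin(2 arctan(l cos(k/2)/sin(k/2))) · (sin²(k/2) + l² cos²(k/2)) = l sin k`. -/
theorem weight_identity (l : ℝ) {k : ℝ} (hk : sin (k / 2) ≠ 0) :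
    sin (2 * arctan (l * cos (k / 2) / sin (k / 2))) * (sin (k / 2) ^ 2 + l ^ 2 * cos (k / 2) ^ 2) = l * sin k := by
  have h1 : (1 : ℝ) + (l * cos (k / 2) / sin (k / 2)) ^ 2 ≠ 0 := by positivity
  have key : sin (2 * arctan (l * cos (k / 2) / sin (k / 2)))
      = 2 * (l * cos (k / 2) / sin (k / 2)) / (1 + (l * cos (k / 2) / sin (k / 2)) ^ 2) := by
    rw [eq_div_iff h1]; exact sin_two_mul_arctan_mul _
  have hs : sin k = 2 * sin (k / 2) * cos (k / 2) := by
    rw [← sin_two_mul]; congr 1; ring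
  rw [key, hs]
  field_simp

/-- (I2, algebraic part) `cos(2θ) · D = sin²(k/2) - l² cos²(k/2)`. -/
theorem cos_two_theta_identity (l : ℝ) {k : ℝ} (hk : sin (k / 2) ≠ 0) :
    cos (2 * arctan (l * cos (k / 2) / sin (k / 2))) * (sin (k / 2) ^ 2 + l ^ 2 * cos (k / 2) ^ 2)
      = sin (k / 2) ^ 2 - l ^ 2 * cos (k / 2) ^ 2 := by
  have h1 : (1 : ℝ) + (l * cos (k / 2) / sin (k / 2)) ^ 2 ≠ 0 := by positivity
  have key : cos (2 * arctan (l * cos (k / 2) / sin (k / 2)))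
      = (1 - (l * cos (k / 2) / sin (k / 2)) ^ 2) / (1 + (l * cos (k / 2) / sin (k / 2)) ^ 2) := by
    rw [eq_div_iff h1]; exact cos_two_mul_arctan_mul _
  rw [key]
  field_simp

/-- (I0, local form) the ROBIN PHASE is an antiderivative of `-G/2`:
`d/dk arctan(l cos(k/2)/sin(k/2)) = -(1/2) · l/(sin²(k/2) + l² cos²(k/2))`. -/
theorem hasDerivAt_theta (l : ℝ) {k : ℝ} (hk : sin (k / 2) ≠ 0) :
    HasDerivAt (fun x : ℝ => arctan (l * cos (x / 2) / sin (x / 2)))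
      (-(l / (sin (k / 2) ^ 2 + l ^ 2 * cos (k / 2) ^ 2)) / 2) k := by
  have h0 : HasDerivAt (fun x : ℝ => x / 2) (1 / 2) k := by
    simpa using (hasDerivAt_id k).div_const 2
  have hc : HasDerivAt (fun x : ℝ => l * cos (x / 2)) (l * (-sin (k / 2) * (1 / 2))) k := (h0.cos).const_mul l
  have hsn : HasDerivAt (fun x : ℝ => sin (x / 2)) (cos (k / 2) * (1 / 2)) k := h0.sin
  have hq := (hc.div hsn hk).arctan
  refine hq.congr_deriv ?_
  simp only [Pi.div_apply]
  have hp : sin (k / 2) ^ 2 + cos (k / 2) ^ 2 = 1 := sin_sq_add_cos_sq (k / 2)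
  have hD : sin (k / 2) ^ 2 + l ^ 2 * cos (k / 2) ^ 2 ≠ 0 := (denom_pos l hk).ne'
  have hnum : l * (-sin (k / 2) * (1 / 2)) * sin (k / 2) - l * cos (k / 2) * (cos (k / 2) * (1 / 2)) = -(l / 2) := by
    have : l * (-sin (k / 2) * (1 / 2)) * sin (k / 2) - l * cos (k / 2) * (cos (k / 2) * (1 / 2))
        = -(l / 2) * (sin (k / 2) ^ 2 + cos (k / 2) ^ 2) := by ring
    rw [this, hp, mul_one]
  rw [hnum]
  field_simp

/-- `∂θ/∂l = sin(k/2) cos(k/2)/D` (the `λ′`-derivative of the Robin phase, (I2)). -/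
theorem hasDerivAt_theta_param (k : ℝ) (hk : sin (k / 2) ≠ 0) (l : ℝ) :
    HasDerivAt (fun m : ℝ => arctan (m * cos (k / 2) / sin (k / 2)))
      (sin (k / 2) * cos (k / 2) / (sin (k / 2) ^ 2 + l ^ 2 * cos (k / 2) ^ 2)) l := by
  have h0 : HasDerivAt (fun m : ℝ => m * cos (k / 2) / sin (k / 2)) (1 * cos (k / 2) / sin (k / 2)) l :=
    ((hasDerivAt_id l).mul_const (cos (k / 2))).div_const (sin (k / 2))
  have hq := h0.arctan
  refine hq.congr_deriv ?_
  have hD : sin (k / 2) ^ 2 + l ^ 2 * cos (k / 2) ^ 2 ≠ 0 := (denom_pos l hk).ne'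
  field_simp

/-- The NODE PHASE `Ψ(k) = (n k/2 - θ(k))/π` has `Ψ′ = (n + G)/(2π)`: consecutive nodes are `2π/(n+G)` apart to first order, so every node weight
`1/(n+G)` is the local lattice spacing over `2π` (the composite-midpoint structure of T-M1D.49 Lemma 1). -/
theorem hasDerivAt_nodePhase (n l : ℝ) {k : ℝ} (hk : sin (k / 2) ≠ 0) :
    HasDerivAt (fun x : ℝ => (n * x / 2 - arctan (l * cos (x / 2) / sin (x / 2))) / π)
      ((n + l / (sin (k / 2) ^ 2 + l ^ 2 * cos (k / 2) ^ 2)) / (2 * π)) k := by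
  have h1 : HasDerivAt (fun x : ℝ => n * x / 2) (n * 1 / 2) k := ((hasDerivAt_id k).const_mul n).div_const 2
  have h := ((h1.sub (hasDerivAt_theta l hk)).div_const π)
  refine h.congr_deriv ?_
  have hD : sin (k / 2) ^ 2 + l ^ 2 * cos (k / 2) ^ 2 ≠ 0 := (denom_pos l hk).ne'
  field_simp
  ring

end Summit.Ventures.CertifiedManyBodySolver.Conjectures.RobinNodeLattice
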